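import Mathlib
import Summits.ValiantsHypothesis.ValiantsHypothesis.Theorems.NewtonUnitEquationsDissociatedUniformStubExposedGenericDirection
import Summits.ValiantsHypothesis.ValiantsHypothesis.Theorems.NewtonUnitEquationsNewtonTauWeakSignvecCount
import Summits.ValiantsHypothesis.ValiantsHypothesis.Theorems.NewtonUnitEquationsNewtonTauWeakResidueNormalForm

/-!
# `NewtonUnitEquationsNewtonTauWeakResidueDesignHull` — THEOREM G: hull vertices of block-residue level sets

Registered stub `stub_residueDesignHull` of line `binomial-normal-form` (crux `NewtonTauWeak`,
stmt-ValiantsHypothesis-5904, lead c5): the assembly of THEOREM G from its landed pieces.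

Setting.  Exponents `d j ∈ ℕ²` (`j : Fin N`, all nonzero), blocks `B j : Fin s`, moduli `q i ≥ 1`, residues
`r i`.  A set `J ⊆ Fin N` is *admissible* if `|J ∩ B⁻¹ i| ≡ r i (mod q i)` for all `i`, and
`X = {Σ_{j ∈ J} d j : J admissible} ⊆ ℕ²`.  Claim: the convex hull of `X ⊆ ℝ²` has at most
`(4 (N² + N) + 5) (Π q i)²` extreme points — polynomially many, uniformly in the number `Π q i` of residue
classes.

Proof.
* (`ResidueDesignHullAux.extremePoint_eq_canonical`)  An extreme point `e` of `conv X` is strictly exposed by a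
  direction `w` whose height `x ↦ ⟨w, x⟩` is moreover injective on `{0} ∪ {d j}`
  (`NewtonUnitEquationsDissociatedUniform.stub_exposedGenericDirection`), so the values `c j = ⟨w, d j⟩` are
  nonzero and `e = Σ_{J₀} d j` for an admissible `J₀` maximising `Σ_J c j` over admissible `J` (heights are
  additive).  By the exchange normal form `stub_residueNormalForm` (piece G3) the canonical set `Jcan(c, a, b)`
  (positives of in-block rank `≥ b (B j)`, negatives of in-block rank `< a (B j)`, `a i, b i < q i`) is
  admissible with the same value, hence, exposure being strict, `Σ_{Jcan} d j = e`.
* (`ResidueDesignHullAux.canonical_eq_of_signs`)  `Jcan(c, a, b)` depends on `c` only through the signs of the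
  `N * N + N` numbers `c j' - c j`, `c j`, i.e. through the sign vector of the linear functionals
  `w ↦ ⟨w, d j' - d j⟩`, `w ↦ ⟨w, d j⟩` at `w`.
* (`ResidueDesignHullAux.signvec_plane_count`)  `M` linear functionals on `ℝ²` realise at most `4 M + 5` sign
  vectors: for `w 0 > 0` (resp. `< 0`) rescale to the chart `w = (1, t)` (resp. `(-1, t)`), along which the sign
  vector is that of `M` affine functions of `t`, at most `2 M + 1` values each by `stub_signvecCount` (piece G1);
  for `w 0 = 0` at most `3` values.
* (`stub_residueDesignHull`)  Hence the extreme points are images of triples (sign vector, `a`, `b`):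
  at most `(4 (N * N + N) + 5) (Π q i) (Π q i)` of them.

Everything is folklore (planar convexity, exchange argument, arrangements on a line); no named facts, no citations.
No `def`s: the sign-vector map and the canonical-set map are written as explicit lambda terms.
-/

-- Sub = Summit single-conjunct layout: the duplicated namespace component is mandated by the tree.
set_option linter.dupNamespace false

noncomputable section

open scoped BigOperators

namespace Summit.ValiantsHypothesis.ValiantsHypothesis.Theorems.NewtonUnitEquationsNewtonTauWeak

namespace ResidueDesignHullAux

/-- **Sign vectors of linear functionals on the plane.**  For `M` linear functionals `w ↦ ∑ i, w i * u m i`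
on `ℝ²`, the sign vectors `(sign ⟨w, u m⟩)_m` realised by some `w ∈ ℝ²` number at most `4 M + 5`: if
`0 < w 0` the sign vector is that of the affine functions `t ↦ u m 0 + t * u m 1` at `t = w 1 / w 0`
(positive rescaling), if `w 0 < 0` that of `t ↦ -u m 0 + t * u m 1` at `t = w 1 / (-w 0)` — at most
`2 M + 1` values each by `stub_signvecCount` — and if `w 0 = 0` it is one of `sign (u · 1)`, `-sign (u · 1)`,
`0`. [folklore] -/
theorem signvec_plane_count (M : ℕ) (u : Fin M → Fin 2 → ℝ) :
    {v : Fin M → SignType | ∃ w : Fin 2 → ℝ, v = fun m => SignType.sign (∑ i, w i * u m i)}.ncard ≤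
      4 * M + 5 := by
  have hsub : {v : Fin M → SignType | ∃ w : Fin 2 → ℝ, v = fun m => SignType.sign (∑ i, w i * u m i)} ⊆
      ({v : Fin M → SignType | ∃ t : ℝ, v = fun m => SignType.sign (u m 0 + t * u m 1)} ∪
        {v : Fin M → SignType | ∃ t : ℝ, v = fun m => SignType.sign (-u m 0 + t * u m 1)}) ∪
      {fun m => SignType.sign (u m 1), fun m => -SignType.sign (u m 1), fun _ => 0} := by
    rintro v ⟨w, rfl⟩
    rcases lt_trichotomy 0 (w 0) with h0 | h0 | h0
    · refine Or.inl (Or.inl ⟨w 1 / w 0, funext fun m => ?_⟩)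
      have h0' : w 0 ≠ 0 := h0.ne'
      have h : w 0 * u m 0 + w 1 * u m 1 = w 0 * (u m 0 + w 1 / w 0 * u m 1) := by
        field_simp
      rw [Fin.sum_univ_two, h, sign_mul, sign_pos h0, one_mul]
    · refine Or.inr ?_
      have hv : (fun m => SignType.sign (∑ i, w i * u m i)) =
          fun m => SignType.sign (w 1) * SignType.sign (u m 1) := by
        funext m
        rw [Fin.sum_univ_two, ← h0, zero_mul, zero_add, sign_mul]
      rw [hv]
      rcases lt_trichotomy 0 (w 1) with h1 | h1 | h1
      · exact Set.mem_insert_iff.2 (Or.inl (funext fun m => by rw [sign_pos h1, one_mul]))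
      · refine Set.mem_insert_of_mem _ (Set.mem_insert_of_mem _ (Set.mem_singleton_iff.2 ?_))
        exact funext fun m => by rw [← h1, sign_zero, zero_mul]
      · refine Set.mem_insert_of_mem _ (Set.mem_insert_iff.2 (Or.inl (funext fun m => ?_)))
        rw [sign_neg h1, neg_one_mul]
    · refine Or.inl (Or.inr ⟨w 1 / -w 0, funext fun m => ?_⟩)
      have h0' : w 0 ≠ 0 := h0.ne
      have h : w 0 * u m 0 + w 1 * u m 1 = -w 0 * (-u m 0 + w 1 / -w 0 * u m 1) := by
        field_simp
        ring
      rw [Fin.sum_univ_two, h, sign_mul, sign_pos (neg_pos.2 h0), one_mul]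
  have h3 : ({fun m => SignType.sign (u m 1), fun m => -SignType.sign (u m 1), fun _ => 0} :
      Set (Fin M → SignType)).ncard ≤ 3 := by
    refine (Set.ncard_insert_le _ _).trans (Nat.succ_le_succ ((Set.ncard_insert_le _ _).trans ?_))
    rw [Set.ncard_singleton]
  calc {v : Fin M → SignType | ∃ w : Fin 2 → ℝ, v = fun m => SignType.sign (∑ i, w i * u m i)}.ncard
      ≤ (({v : Fin M → SignType | ∃ t : ℝ, v = fun m => SignType.sign (u m 0 + t * u m 1)} ∪
          {v : Fin M → SignType | ∃ t : ℝ, v = fun m => SignType.sign (-u m 0 + t * u m 1)}) ∪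
          {fun m => SignType.sign (u m 1), fun m => -SignType.sign (u m 1), fun _ => 0}).ncard :=
        Set.ncard_le_ncard hsub (Set.toFinite _)
    _ ≤ ({v : Fin M → SignType | ∃ t : ℝ, v = fun m => SignType.sign (u m 0 + t * u m 1)}.ncard +
          {v : Fin M → SignType | ∃ t : ℝ, v = fun m => SignType.sign (-u m 0 + t * u m 1)}.ncard) + 3 :=
        (Set.ncard_union_le _ _).trans (add_le_add (Set.ncard_union_le _ _) h3)
    _ ≤ ((2 * M + 1) + (2 * M + 1)) + 3 :=
        Nat.add_le_add_right (add_le_add (stub_signvecCount M (fun m => u m 0) fun m => u m 1)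
          (stub_signvecCount M (fun m => -u m 0) fun m => u m 1)) 3
    _ = 4 * M + 5 := by ring

/-- **The canonical set only depends on the sign vector.**  The canonical admissible set `Jcan(c, a, b)` of
`stub_residueNormalForm` (positives `0 < c j` of in-block rank `≥ b (B j)` for the key `(c j, j)`, negatives
`c j < 0` of in-block rank `< a (B j)` for the key `(-c j, j)`) is a function of the signs of the numbers `c j` and
`c j' - c j` alone: reading these signs from a vector `v : Fin (N * N + N) → SignType` (pairs `(j', j)` first, via
`finProdFinEquiv`/`finSumFinEquiv`, then singletons `j`), `Jcan(c, a, b)` is the displayed set `F(v, a, b)`.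
[folklore] -/
theorem canonical_eq_of_signs (N s : ℕ) (B : Fin N → Fin s) (c : Fin N → ℝ) (a b : Fin s → ℕ)
    (v : Fin (N * N + N) → SignType)
    (hvs : ∀ j, v (finSumFinEquiv (Sum.inr j)) = SignType.sign (c j))
    (hvp : ∀ j' j, v (finSumFinEquiv (Sum.inl (finProdFinEquiv (j', j)))) = SignType.sign (c j' - c j)) :
    (Finset.univ.filter fun j : Fin N =>
        (0 < c j ∧ b (B j) ≤ (Finset.univ.filter fun j' : Fin N =>
            B j' = B j ∧ 0 < c j' ∧ (c j' < c j ∨ (c j' = c j ∧ j' < j))).card) ∨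
        (c j < 0 ∧ (Finset.univ.filter fun j' : Fin N =>
            B j' = B j ∧ c j' < 0 ∧ (c j < c j' ∨ (c j' = c j ∧ j' < j))).card < a (B j))) =
      Finset.univ.filter fun j : Fin N =>
        (v (finSumFinEquiv (Sum.inr j)) = 1 ∧ b (B j) ≤ (Finset.univ.filter fun j' : Fin N =>
            B j' = B j ∧ v (finSumFinEquiv (Sum.inr j')) = 1 ∧
              (v (finSumFinEquiv (Sum.inl (finProdFinEquiv (j', j)))) = -1 ∨
                (v (finSumFinEquiv (Sum.inl (finProdFinEquiv (j', j)))) = 0 ∧ j' < j))).card) ∨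
        (v (finSumFinEquiv (Sum.inr j)) = -1 ∧ (Finset.univ.filter fun j' : Fin N =>
            B j' = B j ∧ v (finSumFinEquiv (Sum.inr j')) = -1 ∧
              (v (finSumFinEquiv (Sum.inl (finProdFinEquiv (j', j)))) = 1 ∨
                (v (finSumFinEquiv (Sum.inl (finProdFinEquiv (j', j)))) = 0 ∧ j' < j))).card < a (B j)) := by
  simp only [hvs, hvp, sign_eq_one_iff, sign_eq_neg_one_iff, sign_eq_zero_iff, sub_pos, sub_neg, sub_eq_zero]

/-- **Every vertex is the point of a canonical set.**  For nonzero exponents `d j`, every extreme point `e` of the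
convex hull of `X = {Σ_{j ∈ J} d j : J admissible}` is `Σ_{j ∈ Jcan(c, a, b)} d j` for the values
`c j = ⟨w, d j⟩ ≠ 0` of a strictly exposing direction `w` generic for `{0} ∪ {d j}`
(`stub_exposedGenericDirection`) and parameters `a i, b i < q i`: `e = Σ_{J₀} d j` with `J₀` admissible
maximising `Σ_J c j` among admissible sets (heights of subset sums are sums of values), the canonical set of
`stub_residueNormalForm` is admissible of the same value, and a strictly exposed maximum is attained at `e`
only. [folklore] -/
theorem extremePoint_eq_canonical (N s : ℕ) (B : Fin N → Fin s) (q r : Fin s → ℕ) (hq : ∀ i, 1 ≤ q i)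
    (d : Fin N → (Fin 2 →₀ ℕ)) (hd : ∀ j, d j ≠ 0) (e : Fin 2 → ℝ)
    (he : e ∈ Set.extremePoints ℝ
      (convexHull ℝ ((fun e : Fin 2 →₀ ℕ => fun i : Fin 2 => ((e i : ℕ) : ℝ)) ''
        (((Finset.univ.filter fun J : Finset (Fin N) =>
            ∀ i, (J.filter fun j => B j = i).card % q i = r i % q i).image
          fun J => ∑ j ∈ J, d j : Finset (Fin 2 →₀ ℕ)) : Set (Fin 2 →₀ ℕ))))) :
    ∃ (w : Fin 2 → ℝ) (c : Fin N → ℝ) (a b : Fin s → ℕ),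
      (∀ j, c j = ∑ i, w i * ((d j i : ℕ) : ℝ)) ∧
      (∀ i, a i < q i ∧ b i < q i) ∧
      e = fun i => (((∑ j ∈ (Finset.univ.filter fun j : Fin N =>
          (0 < c j ∧ b (B j) ≤ (Finset.univ.filter fun j' : Fin N =>
              B j' = B j ∧ 0 < c j' ∧ (c j' < c j ∨ (c j' = c j ∧ j' < j))).card) ∨
          (c j < 0 ∧ (Finset.univ.filter fun j' : Fin N =>
              B j' = B j ∧ c j' < 0 ∧ (c j < c j' ∨ (c j' = c j ∧ j' < j))).card < a (B j))),
        d j) i : ℕ) : ℝ) := by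
  classical
  obtain ⟨w, e₀, he₀X, rfl, hexp, hinjT⟩ :=
    NewtonUnitEquationsDissociatedUniform.stub_exposedGenericDirection _ (insert 0 (Finset.univ.image d)) e he
  obtain ⟨c, hc⟩ : ∃ c : Fin N → ℝ, ∀ j, c j = ∑ i, w i * ((d j i : ℕ) : ℝ) := ⟨_, fun _ => rfl⟩
  -- heights of subset sums are sums of values
  have hlin : ∀ J : Finset (Fin N), ∑ i, w i * (((∑ j ∈ J, d j) i : ℕ) : ℝ) = ∑ j ∈ J, c j := by
    intro J
    simp only [Finsupp.finsetSum_apply, Nat.cast_sum, Finset.mul_sum, hc]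
    exact Finset.sum_comm
  -- the values are nonzero: the height separates `d j ∈ T` from `0 ∈ T`
  have hc0 : ∀ j, c j ≠ 0 := by
    intro j hj
    refine hd j (hinjT
      (Finset.mem_coe.2 (Finset.mem_insert_of_mem (Finset.mem_image_of_mem d (Finset.mem_univ j))))
      (Finset.mem_coe.2 (Finset.mem_insert_self 0 _)) ?_)
    dsimp only
    rw [← hc j, hj]
    simp
  -- the exposed vertex is an admissible subset sum of maximal value
  obtain ⟨J₀, hJ₀, rfl⟩ := Finset.mem_image.1 he₀X
  have hJ₀adm : ∀ i, (J₀.filter fun j => B j = i).card % q i = r i % q i := (Finset.mem_filter.1 hJ₀).2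
  have hmax : ∀ J' : Finset (Fin N), (∀ i, (J'.filter fun j => B j = i).card % q i = r i % q i) →
      ∑ j ∈ J', c j ≤ ∑ j ∈ J₀, c j := by
    intro J' hJ'
    by_cases heq : ∑ j ∈ J', d j = ∑ j ∈ J₀, d j
    · exact le_of_eq (by rw [← hlin, ← hlin, heq])
    · have hlt := hexp _ (Finset.mem_image.2 ⟨J', Finset.mem_filter.2 ⟨Finset.mem_univ _, hJ'⟩, rfl⟩) heq
      rw [hlin, hlin] at hlt
      exact hlt.le
  -- a maximiser's point is the vertex, by strict exposure
  have huniq : ∀ K : Finset (Fin N), (∀ i, (K.filter fun j => B j = i).card % q i = r i % q i) →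
      ∑ j ∈ K, c j = ∑ j ∈ J₀, c j →
      (fun i : Fin 2 => (((∑ j ∈ J₀, d j) i : ℕ) : ℝ)) = fun i => (((∑ j ∈ K, d j) i : ℕ) : ℝ) := by
    intro K hK hKsum
    by_contra hne
    have hne' : ∑ j ∈ K, d j ≠ ∑ j ∈ J₀, d j := fun h => hne (by rw [h])
    have hlt := hexp _ (Finset.mem_image.2 ⟨K, Finset.mem_filter.2 ⟨Finset.mem_univ _, hK⟩, rfl⟩) hne'
    rw [hlin, hlin, hKsum] at hlt
    exact lt_irrefl _ hlt
  obtain ⟨a, b, hab, hKadm, hKsum⟩ := stub_residueNormalForm N s B q r hq c hc0 J₀ hJ₀adm hmax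
  exact ⟨w, c, a, b, hc, hab, huniq _ hKadm hKsum⟩

end ResidueDesignHullAux

/-- **THEOREM G (hull vertices of block-residue level sets of subset sums are polynomial), registered stub
`stub_residueDesignHull` of line `binomial-normal-form`.**  For nonzero exponents `d j ∈ ℕ²` (`j : Fin N`),
blocks `B`, moduli `q i ≥ 1` and residues `r i`, the convex hull of
`X = {Σ_{j ∈ J} d j : |J ∩ B⁻¹ i| ≡ r i (mod q i) ∀ i}` has at most `(4 (N * N + N) + 5) (Π q i)²`
extreme points.  Proof: every extreme point is `Σ_{j ∈ Jcan} d j` for the canonical set of a strictly exposing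
generic direction `w`
(`ResidueDesignHullAux.extremePoint_eq_canonical`), which is determined by the sign vector of the `N * N + N`
functionals `⟨w, d j' - d j⟩`, `⟨w, d j⟩` (`ResidueDesignHullAux.canonical_eq_of_signs`) — at most
`4 (N * N + N) + 5` of them (`ResidueDesignHullAux.signvec_plane_count`) — and by `(a, b)` with `a i, b i < q i`
(`(Π q i)²` of them). [folklore] -/
theorem stub_residueDesignHull (N s : ℕ) (B : Fin N → Fin s) (q r : Fin s → ℕ) (hq : ∀ i, 1 ≤ q i)
    (d : Fin N → (Fin 2 →₀ ℕ)) (hd : ∀ j, d j ≠ 0) :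
    (Set.extremePoints ℝ (convexHull ℝ ((fun e : Fin 2 →₀ ℕ => fun i : Fin 2 => ((e i : ℕ) : ℝ)) ''
      (((Finset.univ.filter fun J : Finset (Fin N) =>
          ∀ i, (J.filter fun j => B j = i).card % q i = r i % q i).image
        fun J => ∑ j ∈ J, d j : Finset (Fin 2 →₀ ℕ)) : Set (Fin 2 →₀ ℕ))))).ncard ≤
      (4 * (N * N + N) + 5) * (∏ i, q i) ^ 2 := by
  classical
  -- the `N * N + N` linear functionals `w ↦ ⟨w, d j' - d j⟩` and `w ↦ ⟨w, d j⟩`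
  obtain ⟨u, hup, hus⟩ : ∃ u : Fin (N * N + N) → Fin 2 → ℝ,
      (∀ j' j, u (finSumFinEquiv (Sum.inl (finProdFinEquiv (j', j)))) =
        fun i => ((d j' i : ℕ) : ℝ) - ((d j i : ℕ) : ℝ)) ∧
      (∀ j, u (finSumFinEquiv (Sum.inr j)) = fun i => ((d j i : ℕ) : ℝ)) := by
    refine ⟨fun m => Sum.elim
        (fun (p : Fin (N * N)) (i : Fin 2) =>
          ((d (finProdFinEquiv.symm p).1 i : ℕ) : ℝ) - ((d (finProdFinEquiv.symm p).2 i : ℕ) : ℝ))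
        (fun (j : Fin N) (i : Fin 2) => ((d j i : ℕ) : ℝ)) (finSumFinEquiv.symm m),
      fun j' j => ?_, fun j => ?_⟩
    · simp only [Equiv.symm_apply_apply, Sum.elim_inl]
    · simp only [Equiv.symm_apply_apply, Sum.elim_inr]
  -- the canonical set read off from a sign vector and the parameters
  obtain ⟨F, hF⟩ :
      ∃ F : (Fin (N * N + N) → SignType) → (Fin s → ℕ) → (Fin s → ℕ) → Finset (Fin N), ∀ v a b,
      F v a b = Finset.univ.filter fun j : Fin N =>
        (v (finSumFinEquiv (Sum.inr j)) = 1 ∧ b (B j) ≤ (Finset.univ.filter fun j' : Fin N =>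
            B j' = B j ∧ v (finSumFinEquiv (Sum.inr j')) = 1 ∧
              (v (finSumFinEquiv (Sum.inl (finProdFinEquiv (j', j)))) = -1 ∨
                (v (finSumFinEquiv (Sum.inl (finProdFinEquiv (j', j)))) = 0 ∧ j' < j))).card) ∨
        (v (finSumFinEquiv (Sum.inr j)) = -1 ∧ (Finset.univ.filter fun j' : Fin N =>
            B j' = B j ∧ v (finSumFinEquiv (Sum.inr j')) = -1 ∧
              (v (finSumFinEquiv (Sum.inl (finProdFinEquiv (j', j)))) = 1 ∨
                (v (finSumFinEquiv (Sum.inl (finProdFinEquiv (j', j)))) = 0 ∧ j' < j))).card < a (B j)) :=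
    ⟨_, fun _ _ _ => rfl⟩
  -- the realised sign vectors and the parameter box
  obtain ⟨V, hV⟩ : ∃ V : Set (Fin (N * N + N) → SignType),
      V = {v | ∃ w : Fin 2 → ℝ, v = fun m => SignType.sign (∑ i, w i * u m i)} := ⟨_, rfl⟩
  obtain ⟨A, hA⟩ : ∃ A : Finset (Fin s → ℕ), A = Fintype.piFinset fun i => Finset.range (q i) :=
    ⟨_, rfl⟩
  have hmemA : ∀ a : Fin s → ℕ, (∀ i, a i < q i) → a ∈ (A : Set (Fin s → ℕ)) := fun a ha => by
    rw [hA]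
    exact Finset.mem_coe.2 (Fintype.mem_piFinset.2 fun i => Finset.mem_range.2 (ha i))
  have hAcard : A.card = ∏ i, q i := by
    rw [hA, Fintype.card_piFinset]
    simp only [Finset.card_range]
  have hVcard : V.ncard ≤ 4 * (N * N + N) + 5 := by
    rw [hV]
    exact ResidueDesignHullAux.signvec_plane_count _ u
  -- every vertex is the point of the canonical set of a realised sign vector and parameters in the box
  refine (Set.ncard_le_ncard (t := (fun p : (Fin (N * N + N) → SignType) × ((Fin s → ℕ) × (Fin s → ℕ)) =>
      fun i : Fin 2 => (((∑ j ∈ F p.1 p.2.1 p.2.2, d j) i : ℕ) : ℝ)) ''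
        (V ×ˢ ((A : Set (Fin s → ℕ)) ×ˢ (A : Set (Fin s → ℕ))))) ?_).trans ?_
  · intro e he
    obtain ⟨w, c, a, b, hc, hab, he_eq⟩ :=
      ResidueDesignHullAux.extremePoint_eq_canonical N s B q r hq d hd e he
    have hvs : ∀ j, SignType.sign (∑ i, w i * u (finSumFinEquiv (Sum.inr j)) i) = SignType.sign (c j) :=
      fun j => by simp only [hus, hc]
    have hvp : ∀ j' j, SignType.sign (∑ i, w i * u (finSumFinEquiv (Sum.inl (finProdFinEquiv (j', j)))) i) =
        SignType.sign (c j' - c j) := fun j' j => by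
      simp only [hup, hc, mul_sub, Finset.sum_sub_distrib]
    have hAeq := ResidueDesignHullAux.canonical_eq_of_signs N s B c a b
      (fun m => SignType.sign (∑ i, w i * u m i)) hvs hvp
    refine ⟨((fun m => SignType.sign (∑ i, w i * u m i)), a, b),
      Set.mk_mem_prod (by rw [hV]; exact ⟨w, rfl⟩)
        (Set.mk_mem_prod (hmemA a fun i => (hab i).1) (hmemA b fun i => (hab i).2)), ?_⟩
    dsimp only
    rw [hF, ← hAeq]
    exact he_eq.symm
  -- count
  · calc _ ≤ (V ×ˢ ((A : Set (Fin s → ℕ)) ×ˢ (A : Set (Fin s → ℕ)))).ncard := Set.ncard_image_le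
      _ = V.ncard * (A.card * A.card) := by rw [Set.ncard_prod, Set.ncard_prod, Set.ncard_coe_finset]
      _ ≤ (4 * (N * N + N) + 5) * (∏ i, q i) ^ 2 := by
          rw [hAcard, sq]
          exact Nat.mul_le_mul_right _ hVcard

end Summit.ValiantsHypothesis.ValiantsHypothesis.Theorems.NewtonUnitEquationsNewtonTauWeak

end
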